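import Summits.RiemannHypothesis.RiemannHypothesis.Theorems.DBNDefs
import HarnessLib

/-!
# RiemannHypothesis / DBN — far-field-limit admissibility on the boundary line: the typed targets T6 / T6′

Route `RiemannHypothesis/DBN`, column DBN of the RH ladder (human ruling D-0040, RECORD-KEEPING at
`T₀ = 3 000 175 332 800`; cell `pub-dbn`).  This `Defs` file states, verbatim from the theory seat's
`pub-dbn-theory/Sketch2.lean` (sha16 b3a04c43a0b342a5, namespace `DbnTheory2`; THEORY-R2 §5–§6), the
two RH-FREE far-field targets that `Theorems/DBNDefs.lean` deliberately left out because they are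
numerical inequalities:

* `FarFieldLimitAdmissible1D c κ` (T6) — with the descent-lemma multiplier at its far-field limit
  `m = 2/c`, the smeared single probe `S_{c,κ}` (offset `u = 0`) satisfies the one-dimensional
  boundary inequality `(2/c)·S_{c,κ}(ξ,1) ≤ P(ξ,1) = 4/(ξ²+4)` for every real `ξ`;
* `farFieldPairs` — the 14 archived kernel pairs `(c,κ)` of the 2001 certificate with `c ≥ 2.2`;
* `FarFieldLimitPairs` (T6′) — all 14 pairs are admissible at the far-field limit.

T6′ is certified TRUE by interval arithmetic in the cell's data item D1′ (kit j243349 + j243924, two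
code-disjoint lineages, referee-signed `rh-columns/STEP0-PASS-DBN.ok`); sibling `Theorems/` files
turn it into a kernel theorem (exact-rational certificates checked by `decide`).  Pure real analysis
about the objects of `Theorems/DBNDefs.lean` (`probeKernel`, `biweight`): no `ζ`, no `H_t`, no
zeros; nothing here bears on the truth of RH.  `--supports stmt-RiemannHypothesis-0274` (RH-free
bookkeeping of the column; closes nothing; via T1 `BoundaryReduction_holds` it is hypothesis (K) of
the descent lemma at `m = 2/c` for these pairs — effect on Λ ≈ −4·10⁻⁴, MODEL, THEORY-R2 §5; the
Λ-record of the cell is untouched).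
-/

noncomputable section

-- D-0017: `Summit.<S>.<S>.…` is the designed namespace of a single-problem summit.
set_option linter.dupNamespace false

namespace Summit.RiemannHypothesis.RiemannHypothesis.Theorems.DbnTheory

/-- TARGET T6 (RH-FREE) — far-field-limit admissibility on the boundary line: with the multiplier at
its far-field limit `m = 2/c`, the smeared single probe `S_{c,κ}` (offset `u = 0`) satisfies the 1-D
inequality `(2/c) S_{c,κ}(ξ,1) ≤ P(ξ,1) = 4/(ξ²+4)`.  (As `ξ → ∞` the ratio tends to `1` from below iff
`κ² < (7/3)(c²-1)`, the archived far-field condition; the content is the mid field.)  Via T1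
`BoundaryReduction` this is hypothesis (K) of the descent lemma with corner coefficient
`a = 1 - (2/c)S(0,1)`.  Verbatim `DbnTheory2.FarFieldLimitAdmissible1D` of Sketch2.lean. -/
def FarFieldLimitAdmissible1D (c κ : ℝ) : Prop :=
  ∀ ξ : ℝ, (2 / c) * probeKernel c κ 0 ξ 1 ≤ 4 / (ξ^2 + 4)

/-- The 14 archived pairs `(c,κ)` of the 2001 kernel table with `c ≥ 2.2` (the three pairs with
`c ∈ {2.06, 2.08, 2.1}` are mid-field-limited and FAIL at `m = 2/c`, D1′ §4(e)).
Verbatim `DbnTheory2.farFieldPairs` of Sketch2.lean. -/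
def farFieldPairs : List (ℝ × ℝ) :=
  [(2.2, 2.8), (2.75, 3.7), (3, 4.1), (3.25, 4.5), (3.5, 4.9), (4, 5.7), (4.5, 6.4), (5, 7.2), (5.5, 8), (6, 8.7),
   (7, 10.1), (8.5, 12.3), (10, 14.5), (12, 17.4)]

/-- TARGET T6′ (RH-FREE, decidable by 1-D interval arithmetic = THEORY-R2 data item D1′(c)) — all 14
far-field-limited archived pairs are admissible at the far-field limit `m = 2/c`.
Verbatim `DbnTheory2.FarFieldLimitPairs` of Sketch2.lean. -/
def FarFieldLimitPairs : Prop :=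
  ∀ p ∈ farFieldPairs, FarFieldLimitAdmissible1D p.1 p.2

end Summit.RiemannHypothesis.RiemannHypothesis.Theorems.DbnTheory

end
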